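import Summits.ResolutionOfSingularities.ResolutionOfSingularities.Theorems.HilbertSamuelEliminationSigmaMaxModificationsCorridor3WLadderSegmentsCentreNear
import HarnessLib

/-!
# [OURS · L1 W4.2] THE PARTIALLY COMPRESSED UNIT TOWER `unitTowerL b L`: compression of the first `L` gaps only — the object on which the
# near-point geometry of ONE blow-up (recognition geometry (R2)–(R4), stub-2's `dichPlus_nearLocus_succ`) is read at a BIRTH stage, inside
# the strong induction of `…SegmentsHEmpStrong` (crux `SigmaMaxModifications` stmt-ResolutionOfSingularities-18506; conjunct
# `SigmaMaxModificationsCorridor3` stmt-…-19249; line `w_ladder`; RECOGNITION assembly)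

Stub worker res-L1-w42-stub-1 (gen 4). Helper file `--supports stmt-ResolutionOfSingularities-19249 --as helper`; kernel only, no named fact.

WHY. stub-2's one-step lemma (`Helpers.dichPlus_nearLocus_succ`, `…RecognitionNearLocusUnit`) reads the near points of the blow-up at stage
`j` of a tower `T` whose near loci lie INSIDE the centres at all stages `i ≤ j` — true for the compressed localised unit tower, false for
the uncompressed chain (waiting centres miss the near locus). But the fully compressed tower `unitTowerU b` needs (H-emp) on the whole unit,
which is what the induction is proving. `unitTowerL b L` compresses only the first `L` gaps (the waiting stages before the `L`-th blown-up
stage of the unit) and keeps every later stage: it needs (H-emp) only BELOW the relative index `relIdx b L` — available at the `L`-th birth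
inside `Seg.invariant_strong` — and its stage `L + 1` is the chain stage right after the `L`-th genuine step, i.e. the birth stage whose near
locus is to be analysed.

* `Seg.relGapL`, `Seg.relIdxL` (agreement with `relIdx` up to rank `L`, `relIdxL (L+1) = relIdx L + 1`), `Seg.unitTowerL` + unfoldings,
  setting data (local initial stage, `KeySetting`, (F1), permissible centres), `nearLocus_unitTowerL` (near loci = localised near loci of the
  chain at the kept indices), `unitTowerL_C_eq_nearLocus_of_subset` (centre = near locus at a kept stage where the chain's centre contains the
  near locus), `isClosed_hsStratumGE_unitTowerL` (closed `H`-strata on every stage, from the chain's).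

OURS bookkeeping; NOT a statement of the manuscript [Hironaka2017] nor of [CossartJannsenSaito2020]. AI-written; AI review is weaker than expert
review.

References: V. Cossart, U. Jannsen, S. Saito, LNM 2270 (2020), Def. 6.34, Def. 6.38, p. 107 [CossartJannsenSaito2020].
-/

noncomputable section

set_option linter.dupNamespace false -- namespace `…Corridor3.Moving` re-enters `…Corridor3` (module convention of the Moving files)

open CategoryTheory AlgebraicGeometry TopologicalSpace Topology IsLocalRing
open Literature.AlgebraicGeometry.Resolution Literature.RingTheory.HilbertSamuel
open Literature.AlgebraicGeometry.CossartJannsenSaito2020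
open Summit.ResolutionOfSingularities.ResolutionOfSingularities.Theorems.CampaignW42
open Summit.ResolutionOfSingularities.ResolutionOfSingularities.Theorems.SigmaMaxModificationsCorridor3.Helpers

namespace Summit.ResolutionOfSingularities.ResolutionOfSingularities.Theorems.SigmaMaxModificationsCorridor3.Moving.Seg


/-! ## §1. The gap function compressing the first `L` gaps -/

section Cut

variable {B : ℕ → Prop}

/-- [OURS] The gap function of the segment based at `m` compressing only the first `L` gaps (every stage after the `L`-th blown-up stage of the
unit is kept). [folklore] -/
def relGapL (hB : ∀ n, ∃ m, n ≤ m ∧ B m) (m L : ℕ) (k : ℕ) : ℕ :=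
  if k < L then relGap hB m k else 0

/-- [OURS] The relative index of the `k`-th kept stage for `relGapL`. [folklore] -/
abbrev relIdxL (hB : ∀ n, ∃ m, n ≤ m ∧ B m) (m L k : ℕ) : ℕ :=
  BlowupTower.cidx 0 (relGapL hB m L) k

/-- Below rank `L` the gaps are the gen-3 gaps. [folklore] -/
theorem relGapL_of_lt (hB : ∀ n, ∃ m, n ≤ m ∧ B m) (m : ℕ) {L k : ℕ} (hk : k < L) : relGapL hB m L k = relGap hB m k :=
  if_pos hk

/-- From rank `L` on the gaps vanish. [folklore] -/
theorem relGapL_of_le (hB : ∀ n, ∃ m, n ≤ m ∧ B m) (m : ℕ) {L k : ℕ} (hk : L ≤ k) : relGapL hB m L k = 0 :=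
  if_neg (not_lt.mpr hk)

/-- **Up to rank `L` the kept indices are the gen-3 ones.** [folklore] -/
theorem relIdxL_eq_of_le (hB : ∀ n, ∃ m, n ≤ m ∧ B m) (m L : ℕ) : ∀ {k : ℕ}, k ≤ L → relIdxL hB m L k = relIdx hB m k
  | 0, _ => rfl
  | k + 1, hk => by
    have ih : BlowupTower.cidx 0 (relGapL hB m L) k = BlowupTower.cidx 0 (relGap hB m) k := relIdxL_eq_of_le hB m L (Nat.le_of_succ_le hk)
    show BlowupTower.cidx 0 (relGapL hB m L) k + relGapL hB m L k + 1 = BlowupTower.cidx 0 (relGap hB m) k + relGap hB m k + 1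
    rw [ih, relGapL_of_lt hB m (Nat.lt_of_succ_le hk)]

/-- **The stage after the `L`-th kept stage is the NEXT chain stage**: `relIdxL (L + 1) = relIdx L + 1`. [folklore] -/
theorem relIdxL_succ_self (hB : ∀ n, ∃ m, n ≤ m ∧ B m) (m L : ℕ) : relIdxL hB m L (L + 1) = relIdx hB m L + 1 := by
  show BlowupTower.cidx 0 (relGapL hB m L) L + relGapL hB m L L + 1 = _
  rw [relGapL_of_le hB m le_rfl, Nat.add_zero]
  exact congrArg (· + 1) (relIdxL_eq_of_le hB m L le_rfl)

/-- The kept stages of rank `≤ L` are blown up (for a blown-up base). [folklore] -/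
theorem B_add_relIdxL (hB : ∀ n, ∃ m, n ≤ m ∧ B m) {m : ℕ} (hm : B m) (L : ℕ) {k : ℕ} (hk : k ≤ L) : B (m + relIdxL hB m L k) := by
  rw [relIdxL_eq_of_le hB m L hk]; exact B_add_relIdx hB hm k

/-- The skipped stages are not blown up and lie below `relIdx L`. [folklore] -/
theorem not_B_and_lt_of_lt_relGapL (hB : ∀ n, ∃ m, n ≤ m ∧ B m) (m L : ℕ) {k j : ℕ} (hj : j < relGapL hB m L k) :
    ¬ B (m + (relIdxL hB m L k + j + 1)) ∧ relIdxL hB m L k + j + 1 < relIdx hB m L := by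
  by_cases hk : k < L
  · rw [relIdxL_eq_of_le hB m L hk.le]
    rw [relGapL_of_lt hB m hk] at hj
    refine ⟨not_B_add_relIdx_add hB m hj, ?_⟩
    calc relIdx hB m k + j + 1 < relIdx hB m k + relGap hB m k + 1 := by omega
      _ = relIdx hB m (k + 1) := (BlowupTower.cidx_succ 0 _ k).symm
      _ ≤ relIdx hB m L := (BlowupTower.cidx_strictMono 0 _).monotone (Nat.succ_le_of_lt hk)
  · rw [relGapL_of_le hB m (not_lt.mp hk)] at hj
    exact absurd hj (Nat.not_lt_zero j)

end Cut

/-! ## §2. The partially compressed unit tower -/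

section Unit

variable {R : ∀ S : Scheme.{0}, CentreSeq S → Prop} {N : ℕ} {ν : ℕ → ℕ} {k : Type} [Field k]
  {c : ℕ → MarkedStage.{0}} (hc : ∀ n, CanonicalNearStep R N ν (c n) (c (n + 1))) (hRa : OracleAdmissible R)
  (hν : ν ≠ iterPSum N Phi) (h0 : Helpers.CycleInv k N ν (c 0)) (hgen : ∀ n, ∃ m, n ≤ m ∧ (c m).IsBlownUp R N ν)

/-- Under (H-emp) BELOW `relIdx b L`, the stages skipped by `relGapL` have empty localised centres. [folklore] -/
theorem htriv_of_hEmpL {b L : ℕ}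
    (hempL : ∀ n, n < Seg.relIdx hgen b L → ¬ (c (b + n)).IsBlownUp R N ν → (locTower hc hRa hν h0 b).C n = ∅) :
    ∀ q j, j < Seg.relGapL hgen b L q → (locTower hc hRa hν h0 b).C (BlowupTower.cidx 0 (Seg.relGapL hgen b L) q + j + 1) = ∅ :=
  fun q _ hj => hempL _ (Seg.not_B_and_lt_of_lt_relGapL hgen b L hj).2 (Seg.not_B_and_lt_of_lt_relGapL hgen b L (k := q) hj).1

/-- [OURS] **THE PARTIALLY COMPRESSED UNIT TOWER** based at `b`, compressing the first `L` gaps: stages `0 … L` are the blown-up stages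
`b = g_0 < ⋯ < g_L` of the unit read on the local scheme at `x_b`, stage `L + 1` is the chain stage `g_L + 1`, and every later stage is kept.
Needs (H-emp) only below `relIdx b L`. [cite: CossartJannsenSaito2020, Def. 6.38, p. 107] -/
def unitTowerL (b L : ℕ)
    (hempL : ∀ n, n < Seg.relIdx hgen b L → ¬ (c (b + n)).IsBlownUp R N ν → (locTower hc hRa hν h0 b).C n = ∅) : BlowupTower.{0} :=
  (locTower hc hRa hν h0 b).compress 0 (Seg.relGapL hgen b L) (htriv_of_hEmpL hc hRa hν h0 hgen hempL)

variable {b L : ℕ} (hempL : ∀ n, n < Seg.relIdx hgen b L → ¬ (c (b + n)).IsBlownUp R N ν → (locTower hc hRa hν h0 b).C n = ∅)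

/-- The stages of the partially compressed tower. [folklore] -/
theorem unitTowerL_X (q : ℕ) : (unitTowerL hc hRa hν h0 hgen b L hempL).X q = (locTower hc hRa hν h0 b).X (Seg.relIdxL hgen b L q) := rfl

/-- The centres of the partially compressed tower. [folklore] -/
theorem unitTowerL_C (q : ℕ) : (unitTowerL hc hRa hν h0 hgen b L hempL).C q = (locTower hc hRa hν h0 b).C (Seg.relIdxL hgen b L q) := rfl

/-- The initial stage is `Spec 𝒪_{X_b,x_b}`. [cite: CossartJannsenSaito2020, p. 107] -/
theorem unitTowerL_X_zero : (unitTowerL hc hRa hν h0 hgen b L hempL).X 0 = Spec ((c b).W.presheaf.stalk (c b).pt) := rfl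

/-- The initial stage is local at the initial point. [cite: CossartJannsenSaito2020, p. 107] -/
theorem isLocalAt_unitTowerL : IsLocalAt ((unitTowerL hc hRa hν h0 hgen b L hempL).X 0) (basePt hc hRa hν h0 b) :=
  (upTower hc hRa hν h0 b).isLocalAt_localize_zero (c b).pt

/-- `KeySetting` for the partially compressed tower. [cite: CossartJannsenSaito2020, p. 107] -/
theorem keySetting_unitTowerL : KeySetting (unitTowerL hc hRa hν h0 hgen b L hempL) N := by
  have h := (upTower hc hRa hν h0 b).keySetting_localize (c b).pt N (keySetting_upTower hc hRa hν h0 b)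
  exact ⟨h.1, h.2⟩

/-- (F1) at the initial point from (F1) at `x_b`. [cite: CossartJannsenSaito2020, Thm. 10.2] -/
theorem charHypothesis_unitTowerL (h : CharHypothesis (c b).W (c b).pt) :
    CharHypothesis ((unitTowerL hc hRa hν h0 hgen b L hempL).X 0) (basePt hc hRa hν h0 b) :=
  (upTower hc hRa hν h0 b).charHypothesis_localize (c b).pt h

/-- The centres are permissible. [cite: CossartJannsenSaito2020, Def. 3.1, Lemma 5.34 (3)] -/
theorem isPermissible_centreIdeal_unitTowerL (q : ℕ) :
    IdealSheafData.IsPermissible ((unitTowerL hc hRa hν h0 hgen b L hempL).centreIdeal q) :=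
  (upTower hc hRa hν h0 b).isPermissible_centreIdeal_localize (c b).pt _ (isPermissible_centreIdeal_upTower hc hRa hν h0 b _)

/-- **The near loci of the partially compressed tower are the localised near loci of the chain at the kept indices**:
`N^{L}_q = ι⁻¹(N_{relIdxL q})`. [cite: CossartJannsenSaito2020, Def. 6.34 (ii), p. 107] -/
theorem nearLocus_unitTowerL (q : ℕ) :
    (unitTowerL hc hRa hν h0 hgen b L hempL).nearLocus N (basePt hc hRa hν h0 b) q =
      (locι hc hRa hν h0 b (Seg.relIdxL hgen b L q)).base ⁻¹' (upTower hc hRa hν h0 b).nearLocus N (c b).pt (Seg.relIdxL hgen b L q) := by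
  haveI : IsLocallyNoetherian ((upTower hc hRa hν h0 b).X 0) := (upTower hc hRa hν h0 b).ln 0
  haveI := flat_fromSpecStalk ((upTower hc hRa hν h0 b).X 0) ((c b).pt : (upTower hc hRa hν h0 b).X 0)
  have h1 : (unitTowerL hc hRa hν h0 hgen b L hempL).nearLocus N (basePt hc hRa hν h0 b) q =
      (locTower hc hRa hν h0 b).nearLocus N (basePt hc hRa hν h0 b) (Seg.relIdxL hgen b L q) :=
    (locTower hc hRa hν h0 b).nearLocus_compress_zero (htriv_of_hEmpL hc hRa hν h0 hgen hempL) N (basePt hc hRa hν h0 b) q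
  have h2 := (upTower hc hRa hν h0 b).nearLocus_baseChange
    (((upTower hc hRa hν h0 b).X 0).fromSpecStalk ((c b).pt : (upTower hc hRa hν h0 b).X 0)) N (basePt hc hRa hν h0 b) (Seg.relIdxL hgen b L q)
  rw [show (((upTower hc hRa hν h0 b).X 0).fromSpecStalk ((c b).pt : (upTower hc hRa hν h0 b).X 0)).base (basePt hc hRa hν h0 b) = (c b).pt
    from Scheme.fromSpecStalk_closedPoint] at h2
  rw [h1]
  exact h2

/-- **At a kept stage where the chain's centre CONTAINS the near locus, the centre of the partially compressed tower IS its near locus** (over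
a base isolated in its stratum; `…CentreNear.locTower_C_eq_preimage_nearLocus`). [cite: CossartJannsenSaito2020, Def. 6.38 (iii)] -/
theorem unitTowerL_C_eq_nearLocus_of_subset {p : ℕ} {X : Scheme.{0}} [IsLocallyNoetherian X] {x : X} (hX : IsMaximalOrigin p N ν X x)
    (hreach : Reaches R N ν (MarkedStage.init X x) (c 0))
    (hU : ∃ U : Set (c b).W, IsOpen U ∧ (c b).pt ∈ U ∧ U ∩ Scheme.hsStratum (c b).W N ν ⊆ {(c b).pt}) (q : ℕ)
    (hNC : (upTower hc hRa hν h0 b).nearLocus N (c b).pt (Seg.relIdxL hgen b L q) ⊆ (upTower hc hRa hν h0 b).C (Seg.relIdxL hgen b L q)) :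
    (unitTowerL hc hRa hν h0 hgen b L hempL).C q = (unitTowerL hc hRa hν h0 hgen b L hempL).nearLocus N (basePt hc hRa hν h0 b) q := by
  rw [unitTowerL_C, nearLocus_unitTowerL]
  exact locTower_C_eq_preimage_nearLocus hc hRa hν h0 hX hreach b hU _ hNC

/-- `H` on a stage of the partially compressed tower is `H` of the chain stage under the comparison map. [cite: CossartJannsenSaito2020, Lemma 2.27 (1)] -/
theorem hsFun_unitTowerL (q : ℕ) (y : (unitTowerL hc hRa hν h0 hgen b L hempL).X q) :
    Scheme.hsFun ((unitTowerL hc hRa hν h0 hgen b L hempL).X q) N y =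
      Scheme.hsFun (c (b + Seg.relIdxL hgen b L q)).W N ((locι hc hRa hν h0 b (Seg.relIdxL hgen b L q)).base y) := by
  haveI : IsLocallyNoetherian ((upTower hc hRa hν h0 b).X 0) := (upTower hc hRa hν h0 b).ln 0
  haveI := flat_fromSpecStalk ((upTower hc hRa hν h0 b).X 0) ((c b).pt : (upTower hc hRa hν h0 b).X 0)
  exact (upTower hc hRa hν h0 b).hsFun_baseChange _ N _ y

/-- **The `H`-strata `X(≥ μ)` of every stage of the partially compressed tower are closed** (preimages of those of the chain stages).
[cite: CossartJannsenSaito2020, Lemma 2.36] -/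
theorem isClosed_hsStratumGE_unitTowerL (q : ℕ) (μ : ℕ → ℕ) :
    IsClosed (Scheme.hsStratumGE ((unitTowerL hc hRa hν h0 hgen b L hempL).X q) N μ) := by
  have hcyc : Helpers.CycleInv k N ν (c (b + Seg.relIdxL hgen b L q)) := cycleInv_at hc hRa hν h0 _
  have heq : Scheme.hsStratumGE ((unitTowerL hc hRa hν h0 hgen b L hempL).X q) N μ =
      (locι hc hRa hν h0 b (Seg.relIdxL hgen b L q)).base ⁻¹' Scheme.hsStratumGE (c (b + Seg.relIdxL hgen b L q)).W N μ := by
    ext y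
    have e := hsFun_unitTowerL hc hRa hν h0 hgen hempL q y
    constructor
    · intro hy
      have hy' : μ ≤ Scheme.hsFun ((unitTowerL hc hRa hν h0 hgen b L hempL).X q) N y := Scheme.mem_hsStratumGE_iff.mp hy
      rw [e] at hy'
      exact Scheme.mem_hsStratumGE_iff.mpr hy'
    · intro hy
      have hy' : μ ≤ Scheme.hsFun (c (b + Seg.relIdxL hgen b L q)).W N ((locι hc hRa hν h0 b (Seg.relIdxL hgen b L q)).base y) :=
        Scheme.mem_hsStratumGE_iff.mp hy
      rw [← e] at hy'
      exact Scheme.mem_hsStratumGE_iff.mpr hy'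
  rw [heq]
  exact (isClosed_hsStratumGE_of_cycleInv hcyc μ).preimage (locι hc hRa hν h0 b _).continuous

end Unit

end Summit.ResolutionOfSingularities.ResolutionOfSingularities.Theorems.SigmaMaxModificationsCorridor3.Moving.Seg

end
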